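import Summits.QuantumFields.YangMills.Theorems.BalabanUVNodesN12MinimiserFamilyOfClassNearFlatCoercive
import Summits.QuantumFields.YangMills.Theorems.BalabanUVNodesN12HVelocityOfClass
import HarnessLib

/-!
# BalabanUVNodes ∕ N12 — KNIT LINK #2, NEAR-FLAT EDITION: THE w1 LINEAGE’s (J0′) CHART THEOREM AT `𝐁_k(Z)` OVER THE LANE’s TOWER PRODUCER WITH THE (β) ROW SPLIT INTO (δ) + (P) + (M) —
# per base field the consumer supplies (E) the minimiser, the datum’s scale-`k` regularity on `Z`, the near-flat gauge letter (δ), the flat coercivity (P), the multiplier letter (M) and (T1@q₀)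
# ([Balaban1985Variational] Thm 1 p. 279, (2),(4),(7) pp. 277–278, (16)–(18) p. 280, Sect. C (44)–(48) p. 285, (82)–(83) p. 290, Prop. 8 p. 305, Prop. 9 (190) p. 309; [Balaban1989LargeFieldI] (1.74) p. 192,
# p. 193 ll. 14–20, Prop. 1 p. 194; [Balaban1989LargeFieldII] (1.9) p. 358, (1.12) p. 359; [Balaban1988Convergent] (2.2) p. 255, (2.10)–(2.13) pp. 256–257; [Balaban1985Averaging] Prop. 2 p. 26;
# [Balaban1987RG1] (0.4) p. 253)

Cell `pub-ymgap` (HUMAN RULINGS D-0062 ∕ D-0149), seat `pub-ymgap-dag-n12-d` g23 (R134 N12 [B15] s2 = by-name knit at the record; census item E1 = the (J0′) row); count-neutral helper of K1⁹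
`stmt-QuantumFields-27364` (`--kind proof --supports … --as helper`).  THEOREMS ONLY (0 `def`, 0 `instance`, 0 `sorry`); three compositions BY NAME, nothing modified.  SIBLING of
`N12MinimiserFamilyAtRecordBjTower` (p710140, over the capstone `N12MinimiserFamilyOfClassTowerGuards` whose per-base-field positivity row is (β) = positivity of the real second variation of the
LAGRANGIAN on the `DΦ₀(0)`-kernel — nobody's typed interface): THIS FILE is the same composition over the lane's NEAR-FLAT capstone `N12MinimiserFamilyOfClassNearFlatCoercive.hMin_atRecord_of_node00Letters_thm1AtBase_central_ofClass_nearFlat`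
(dag-n12-c g25), in which (β) is DERIVED along print's road [LF-II] p. 358 «(1.9) ⟸ (1.7) + (1.8)» (`B15Prop1RealCoerciveFromNearFlatExpansion.realSecondVariation_pos_of_flatCoercive_of_multiplier`,
over dag-n12-w2's PROVED (1.7) letter) from three per-base-field rows: (δ) the minimiser bondwise `δc`-flat on the plaquettes meeting a bond sourced in `Ω₁(Z)` (a GAUGE letter — the direct
road's (N)-package clause), (P) FLAT coercivity `cP·Σ_b‖p_b‖² ≤ d²∕ds² A(exp(s p)·1)|₀` on the real kernel of `DΦ₀(0)` ((1.8) ∕ [10] (1.67) currency — b5 ∕ N12-own), (M) the MULTIPLIER letter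
`Re ℓ₀(D²Φ₀(0)[p̂,p̂]) ≤ m·Σ_b‖p_b‖²` ([15] (79) `Δ₁` currency — dag-n12-w6's (R1) road), and once per height `0 ≤ δc`, `64(d−1)δc + m < cP`.  As in the sibling, the class facts (w1 g4), the
forest + axial slice (w3), `a`∕`Φ₀` (`rfl`) and [15] (45) in velocity currency (w6 p708777) are discharged BY NAME; (P) and (M) are displayed ON EVERY FOREST AXIAL SLICE with `a`, `Φ₀`
inlined by their formulas (the consumer does not know w3's forest).  Per base field the consumer supplies EXACTLY: (E) `IsMinimizer`, the datum's scale-`k` regularity on `Z`, (δ), (P), (M),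
(T1@q₀).  Three shapes: compact-`K`, `hMinC`, closed guard (the one the knit-row junction `N12MinimiserFamilyKnitRowTower` consumes).

HONEST FRAMING ∕ LOCATED.  Compositions by name; (E), the datum row, (δ), (P), (M), (T1@q₀), the per-height letters and the numerics stay DISPLAYED — (E)∕(P)∕(T1@q₀) are NODE 00 ∕ N07 ∕ b5
currencies ([15] Thm 1 existence; (1.8)∕[10] (1.67); [15] Thm 1 uniqueness), (δ) is a gauge letter of the direct road's window package, (M) has dag-n12-w6's producer road (R1) — none
discharged here; the per-height letters are EXISTENCE constants (census U4; print's volume-uniform (46)∕(83) NOT claimed); nothing of Bałaban's estimates asserted; N12 NOT discharged; K1⁹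
NOT closed; counts unmoved; one finite 𝕋⁴ programme at fixed `ε = L^{-K}` — R4 closes the conditional rung `BalabanLadder.UV` only; no summit statement is proved here and NOT the
Yang–Mills mass gap (Clay); nothing continuum ∕ ℝ⁴ ∕ OS.
-/

noncomputable section

namespace Summit.QuantumFields.YangMills.BalabanUVNodes.N12MinimiserFamilyAtRecordBjTowerNearFlat

open scoped BigOperators Matrix.Norms.L2Operator Topology
open Literature.MathematicalPhysics.QuantumFieldTheory.Balaban1983to89
open T4Continuum
open B15DeterminingSets GaugeField
open ExpMeanLog (expMeanLogSU deltaSU)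
open T4AdjointCovarianceUnitary (lieSU)
open Node00
open B15SU2ChartHolomorphic (genE)
open B15Prop1AnalyticExtClause (cplxVec)
open B15Prop1ChartCalculusSU2 (E3)
open T4CubeChartGnomonic (SU2)
open B14.Eq213DetSet (Bj maxDomT Bj_of_gt)
open B14.Eq213MaximalDomains (side)
open B14.Eq22Determines (IsBlockUnion)
open B14.Eq216Concrete (feeds)
open B5Eq118OneStroke (iterBlockOf)
open B15Eq112TorusCover (lift)
open T4AxialGaugeSmallField (boxPlaqs)
open B15Prop1Carrier (plaqsInside)
open Summit.QuantumFields.YangMills.BalabanUVNodes.N12ClassLetterGeometryOfRecord (classLetters_closure_regMSCoPOfRecord_Bj)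
open Summit.QuantumFields.YangMills.BalabanUVNodes.N12ForestSlice (exists_forest_slice_Bj)
open Summit.QuantumFields.YangMills.BalabanUVNodes.N12MinimiserFamilyOfClassNearFlatCoercive (hMin_atRecord_of_node00Letters_thm1AtBase_central_ofClass_nearFlat)
open Summit.QuantumFields.YangMills.BalabanUVNodes.N12HVelocityOfClass (hH_velocity_Bj_of_isMinimizer_class)
open Literature.MathematicalPhysics.QuantumFieldTheory.BalabanImbrieJaffe1984to88.BIJ85Eq453GaugeField (qsstarGIter0)
open B15AveragingHolomorphic (iterMh)
open B15SU2ChartHolomorphic (expMulC logCoordC)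
open B15ShellGauge193 (shellGauge)
open B15Extension193 (extend)
open B16Sect1Backgrounds (toMS expMul)
open B15Prop1ChartSU2 (su2Chart)
open Metric (ball)
open B15Prop1ClosedGuardUniformRadius (forall_of_forall_isCompact_subset)

variable {F : T4Family} {k : ℕ}


/-! ## §1  (J0′) `hMin` at `𝐁_k(Z)` from (E) + the datum's regularity on `Z` + (δ) + (P) + (M) + (T1@q₀) — the lineage's output shape -/

/-- ★★★ **(J0′) `hMin` AT THE RECORD's `𝐁_k(Z)` FROM PRINT's PER-BASE-FIELD LETTERS, OVER THE LANE's NEAR-FLAT TOWER CAPSTONE** — the sibling's `hMin_atRecord_Bj_of_printLetters_ofClassTower`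
with the (β) row REPLACED by (δ) + (P) + (M) (print's road (1.9) ⟸ (1.7) + (1.8), the lane's `realSecondVariation_pos_of_flatCoercive_of_multiplier` inside the capstone).  Per base field
`V_k ∈ K`: (E) the (2.12) minimiser `U₀`; the datum's regularity `PlaqSmallOn (plaqsInside (pts k Z)) δ (ext V_k)`; (δ) `U₀` bondwise `δc`-flat on the plaquettes meeting a bond sourced in
`Ω₁(Z)`; (P) flat coercivity and (M) the multiplier letter, both on every forest axial slice through the constrained towers (`a`, `Φ₀` inlined; kernel in `DΦ₀(0)` currency); (T1@q₀) over
the closure of the class.  Once per height: `ρ″` + floors, `hHB` + `εreg ≤ εH`, `0 ≤ δc`, `64(d−1)δc + m < cP`; numerics.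
[cite: Balaban1985Variational, Thm 1 p.279, (2),(4),(7) pp.277–278, (16)–(18) p.280, Sect. C (44)–(48) p.285, (79) p.290, (82)–(83) p.290, Prop. 8 p.305, Prop. 9 (190) p.309; Balaban1989LargeFieldI, (1.74) p.192, p.193 L14–20, Prop. 1 p.194; Balaban1989LargeFieldII, (1.7)–(1.9) p.358, (1.12) p.359; Balaban1988Convergent, (2.2) p.255, (2.10)–(2.13) pp.256–257; Balaban1985Averaging, Prop. 2 (52)–(54) p.26; Balaban1987RG1, (0.4) p.253] -/
theorem hMin_atRecord_Bj_of_printLetters_ofClassTowerNearFlat (ν : Node00.Stage7Numerics) (Kt : ℕ) (hd3 : 3 ≤ (F.P Kt).d) (Z : Set (Site (F.P Kt) 0))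
    (Λ : Set (Site (F.P Kt) k)) (lo hi : Fin (F.P Kt).d → ℤ) (hkK : k + 1 ≤ (F.P Kt).m + (F.P Kt).K) (hk1 : 1 ≤ k)
    (hdiv : side (F.P Kt).L ν.M₁ k ∣ (F.P Kt).sitesPerDir 0) (hfloor : ((F.P Kt).d + 14) * (F.P Kt).L ≤ ν.M₁) (hZblk : IsBlockUnion k Z) (hε : 0 < ν.εreg)
    (hα3 : (143 * (((((F.P Kt).d + 4 : ℕ) : ℝ)) ^ 2 / 4) ^ 2) * (2 * ((F.P Kt).L : ℝ) ^ 2 * ν.εreg) ≤ 1 / 3)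
    (hα2 : 2 * (2 * ((F.P Kt).L : ℝ) ^ 2 * ν.εreg) ≤ 2 * deltaSU (Fin 2) / ((((F.P Kt).d + 4) * (F.P Kt).L : ℕ) : ℝ) ^ 2)
    -- the per-HEIGHT letters: `ρ″` with its two volume-free floors, dag-n12-w6's (P4)′ proxies letter `hHB` at `(εH, B)` with `εreg ≤ εH`, and the numerics of the (β) split:
    -- the near-flat tolerance `δc`, the flat coercivity constant `cP`, the multiplier constant `m`, with `64(d−1)·δc + m < cP`
    {ρ'' : ℝ} (hsbU : ∀ W : GaugeField (F.P Kt) 0 SU2, ‖coeField W - 1‖ ≤ ρ'' → SmallBelow (Node00.avOfRecord F 2 Kt) k W)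
    (hερ : 6 * ((((F.P Kt).d - 1 : ℕ)) : ℝ) * (F.P Kt).L * ν.εreg ≤ ρ'') {δ : ℝ} (hδ : 0 < δ) (hδρ : 6 * ((((F.P Kt).d - 1 : ℕ)) : ℝ) * (F.P Kt).L ^ k * δ ≤ ρ'')
    {εH B : ℝ}
    (hHB : ∀ (Wd : MSField (F.P Kt) SU2) (U₀ : GaugeField (F.P Kt) 0 SU2),
      AgreeOn (Bj ν.M₁ Z k) (avgFamily (avOfRecord F 2 Kt) U₀) Wd →
      (∀ i' : Fin (constrCard (Bj ν.M₁ Z k) k), ∃ U' : GaugeField (F.P Kt) 0 SU2,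
        (∀ b ∈ feeds (((constrEnum (Bj ν.M₁ Z k) k).symm i').1 : ℕ) ((constrEnum (Bj ν.M₁ Z k) k).symm i').2.1, U' b = U₀ b) ∧
          SmallBelow (avOfRecord F 2 Kt) k U') →
      (∀ (j : ℕ), 1 ≤ j → j ≤ k → ∀ y : Site (F.P Kt) j, embIter j y ∈ maxDomT ν.M₁ Z j → ∃ U' : GaugeField (F.P Kt) 0 SU2,
        (∀ c : PBond (F.P Kt) j, (c.src = y ∨ c.tgt = y) → ∀ b₀ : PBond (F.P Kt) 0,
          (iterBlockOf j b₀.src = c.src ∨ iterBlockOf j b₀.src = c.tgt) → (iterBlockOf j b₀.tgt = c.src ∨ iterBlockOf j b₀.tgt = c.tgt) → U' b₀ = U₀ b₀) ∧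
        SmallBelow (avOfRecord F 2 Kt) k U') →
      (∀ (j : ℕ), 1 ≤ j → j ≤ k → ∀ y : Site (F.P Kt) j, embIter j y ∈ maxDomT ν.M₁ Z j →
        PlaqSmallOn (boxPlaqs (fun κ => lift (F.P Kt) (embIter j y) κ - ((((F.P Kt).L ^ j : ℕ) : ℤ) + ((((F.P Kt).L ^ j - 1) / 2 : ℕ) : ℤ)))
          (fun κ => lift (F.P Kt) (embIter j y) κ + ((((F.P Kt).L ^ j : ℕ) : ℤ) + ((((F.P Kt).L ^ j - 1) / 2 : ℕ) : ℤ))) : Set (Plaq (F.P Kt) 0)) εH U₀) →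
      ∃ H : (Fin (constrCard (Bj ν.M₁ Z k) k) → lieSU (Fin 2)) → PBond (F.P Kt) 0 → lieSU (Fin 2),
        (∀ v, fderiv ℝ (msChart F 2 Kt k (Bj ν.M₁ Z k) Wd U₀) 0 (H v) = v) ∧ ∀ v, Real.sqrt (∑ b, ‖H v b‖ ^ 2) ≤ B * ‖v‖)
    (hεH : ν.εreg ≤ εH)
    {δc cP m : ℝ} (hδc0 : 0 ≤ δc) (hnum : 64 * (((F.P Kt).d : ℝ) - 1) * δc + m < cP)
    (ext : GaugeField (F.P Kt) k SU2 → GaugeField (F.P Kt) k SU2) (hext : ∀ W, ext W = extend Λ (shellGauge W lo hi) W)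
    {K : Set (GaugeField (F.P Kt) k SU2)} (hK : IsCompact K) {𝓐₀ : ℝ} (h𝓐₀ : 1 < 𝓐₀)
    (hbase : ∀ Vk ∈ K, ∃ U₀ : GaugeField (F.P Kt) 0 SU2,
      IsMinimizer (Node00.avOfRecord F 2 Kt) (Node00.regMSCoPOfRecord F 2 ν Kt k (maxDomT ν.M₁ Z)) (Bj ν.M₁ Z k)
        (avgFamily (Node00.avOfRecord F 2 Kt) (qsstarGIter0 k (ext Vk))) U₀ ∧
      -- the DATUM's scale-`k` regularity on `Z` (the p. 193 extension `Ṽ_k = ext V_k`; the road's `B15ShellGauge193Local.dist1_plaqHol_extend_shellGauge_le`)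
      PlaqSmallOn (plaqsInside (pts k Z)) δ (ext Vk) ∧
      -- (δ) DISPLAYED (GAUGE letter, the direct road's (N)-package clause): `U₀` bondwise `δc`-flat on the plaquettes meeting a bond sourced in `Ω₁(Z)`
      (∀ q : Plaq (F.P Kt) 0, ((⟨q.src, q.μ⟩ : PBond (F.P Kt) 0) ∈ {b : PBond (F.P Kt) 0 | b.src ∈ maxDomT ν.M₁ Z 1} ∨
          (⟨q.src.shift q.μ, q.ν⟩ : PBond (F.P Kt) 0) ∈ {b : PBond (F.P Kt) 0 | b.src ∈ maxDomT ν.M₁ Z 1} ∨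
          (⟨q.src.shift q.ν, q.μ⟩ : PBond (F.P Kt) 0) ∈ {b : PBond (F.P Kt) 0 | b.src ∈ maxDomT ν.M₁ Z 1} ∨
          (⟨q.src, q.ν⟩ : PBond (F.P Kt) 0) ∈ {b : PBond (F.P Kt) 0 | b.src ∈ maxDomT ν.M₁ Z 1}) →
        ‖((U₀ ⟨q.src, q.μ⟩ : SU2) : Matrix (Fin 2) (Fin 2) ℂ) - 1‖ ≤ δc ∧ ‖((U₀ ⟨q.src.shift q.μ, q.ν⟩ : SU2) : Matrix (Fin 2) (Fin 2) ℂ) - 1‖ ≤ δc ∧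
          ‖((U₀ ⟨q.src.shift q.ν, q.μ⟩ : SU2) : Matrix (Fin 2) (Fin 2) ℂ) - 1‖ ≤ δc ∧ ‖((U₀ ⟨q.src, q.ν⟩ : SU2) : Matrix (Fin 2) (Fin 2) ℂ) - 1‖ ≤ δc) ∧
      -- (P) DISPLAYED ON EVERY FOREST AXIAL SLICE: FLAT COERCIVITY on the real kernel of `DΦ₀(0)` (`Φ₀` inlined) — [LF-II] (1.8) ∕ [10] (1.67) currency
      (∀ (S : Submodule ℂ (VecField (F.P Kt) 0 (EuclideanSpace ℂ (Fin 3)))) (path : Site (F.P Kt) 0 → List (LStep (F.P Kt) 0)),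
        (∀ x, ∀ s ∈ path x, ∃ x' x'' : Site (F.P Kt) 0, path x'' = path x' ++ [s] ∧
          (s.fwd = true → s.bond.src = x' ∧ s.bond.tgt = x'') ∧ (s.fwd = false → s.bond.src = x'' ∧ s.bond.tgt = x')) →
        (∀ j, j ≤ k → ∀ c ∈ bondsOf (Bj ν.M₁ Z k j), path (embIter j c.src) = [] ∧ path (embIter j c.tgt) = []) →
        (∀ X : VecField (F.P Kt) 0 (EuclideanSpace ℂ (Fin 3)), X ∈ S ↔ ∀ x, ∀ s ∈ path x, X s.bond = 0) →
        ∀ (p : VecField (F.P Kt) 0 E3) (hp : cplxVec p ∈ S), fderiv ℂ (fun (X : S) (i : Fin (constrCard (Bj ν.M₁ Z k) k)) =>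
                logCoordC (star ((avgFamily (Node00.avOfRecord F 2 Kt) (qsstarGIter0 k (ext Vk))
                  ((constrEnum (Bj ν.M₁ Z k) k).symm i).1 ((constrEnum (Bj ν.M₁ Z k) k).symm i).2.1 : SU2) : Matrix (Fin 2) (Fin 2) ℂ) *
                  iterMh ((constrEnum (Bj ν.M₁ Z k) k).symm i).1 (expMulC (X : VecField (F.P Kt) 0 (EuclideanSpace ℂ (Fin 3))) (coeField U₀))
                    ((constrEnum (Bj ν.M₁ Z k) k).symm i).2.1)) 0 ⟨cplxVec p, hp⟩ = 0 →
          cP * ∑ b : PBond (F.P Kt) 0, ‖p b‖ ^ 2 ≤ deriv (deriv fun s : ℝ => wilsonAction4 (expMul su2Chart (s • p) (1 : GaugeField (F.P Kt) 0 SU2))) 0) ∧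
      -- (M) DISPLAYED ON EVERY FOREST AXIAL SLICE: the MULTIPLIER letter (`a`, `Φ₀` inlined) — [15] (79) p.290 `Δ₁` currency, dag-n12-w6's (R1) road
      (∀ (S : Submodule ℂ (VecField (F.P Kt) 0 (EuclideanSpace ℂ (Fin 3)))) (path : Site (F.P Kt) 0 → List (LStep (F.P Kt) 0)),
        (∀ x, ∀ s ∈ path x, ∃ x' x'' : Site (F.P Kt) 0, path x'' = path x' ++ [s] ∧
          (s.fwd = true → s.bond.src = x' ∧ s.bond.tgt = x'') ∧ (s.fwd = false → s.bond.src = x'' ∧ s.bond.tgt = x')) →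
        (∀ j, j ≤ k → ∀ c ∈ bondsOf (Bj ν.M₁ Z k j), path (embIter j c.src) = [] ∧ path (embIter j c.tgt) = []) →
        (∀ X : VecField (F.P Kt) 0 (EuclideanSpace ℂ (Fin 3)), X ∈ S ↔ ∀ x, ∀ s ∈ path x, X s.bond = 0) →
        ∀ ℓ₀ : (Fin (constrCard (Bj ν.M₁ Z k) k) → EuclideanSpace ℂ (Fin 3)) →L[ℂ] ℂ, fderiv ℂ (fun X : S => ∑ p : Plaq (F.P Kt) 0, (1 - (expMulC (X : VecField (F.P Kt) 0 (EuclideanSpace ℂ (Fin 3))) (coeField U₀) ⟨p.src, p.μ⟩ *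
              expMulC (X : VecField (F.P Kt) 0 (EuclideanSpace ℂ (Fin 3))) (coeField U₀) ⟨p.src.shift p.μ, p.ν⟩ *
              Matrix.adjugate (expMulC (X : VecField (F.P Kt) 0 (EuclideanSpace ℂ (Fin 3))) (coeField U₀) ⟨p.src.shift p.ν, p.μ⟩) *
              Matrix.adjugate (expMulC (X : VecField (F.P Kt) 0 (EuclideanSpace ℂ (Fin 3))) (coeField U₀) ⟨p.src, p.ν⟩)).trace / 2)) 0 = ℓ₀.comp (fderiv ℂ (fun (X : S) (i : Fin (constrCard (Bj ν.M₁ Z k) k)) =>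
                logCoordC (star ((avgFamily (Node00.avOfRecord F 2 Kt) (qsstarGIter0 k (ext Vk))
                  ((constrEnum (Bj ν.M₁ Z k) k).symm i).1 ((constrEnum (Bj ν.M₁ Z k) k).symm i).2.1 : SU2) : Matrix (Fin 2) (Fin 2) ℂ) *
                  iterMh ((constrEnum (Bj ν.M₁ Z k) k).symm i).1 (expMulC (X : VecField (F.P Kt) 0 (EuclideanSpace ℂ (Fin 3))) (coeField U₀))
                    ((constrEnum (Bj ν.M₁ Z k) k).symm i).2.1)) 0) →
          ∀ (p : VecField (F.P Kt) 0 E3) (hp : cplxVec p ∈ S), fderiv ℂ (fun (X : S) (i : Fin (constrCard (Bj ν.M₁ Z k) k)) =>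
                logCoordC (star ((avgFamily (Node00.avOfRecord F 2 Kt) (qsstarGIter0 k (ext Vk))
                  ((constrEnum (Bj ν.M₁ Z k) k).symm i).1 ((constrEnum (Bj ν.M₁ Z k) k).symm i).2.1 : SU2) : Matrix (Fin 2) (Fin 2) ℂ) *
                  iterMh ((constrEnum (Bj ν.M₁ Z k) k).symm i).1 (expMulC (X : VecField (F.P Kt) 0 (EuclideanSpace ℂ (Fin 3))) (coeField U₀))
                    ((constrEnum (Bj ν.M₁ Z k) k).symm i).2.1)) 0 ⟨cplxVec p, hp⟩ = 0 →
            (ℓ₀ (fderiv ℂ (fderiv ℂ (fun (X : S) (i : Fin (constrCard (Bj ν.M₁ Z k) k)) =>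
                logCoordC (star ((avgFamily (Node00.avOfRecord F 2 Kt) (qsstarGIter0 k (ext Vk))
                  ((constrEnum (Bj ν.M₁ Z k) k).symm i).1 ((constrEnum (Bj ν.M₁ Z k) k).symm i).2.1 : SU2) : Matrix (Fin 2) (Fin 2) ℂ) *
                  iterMh ((constrEnum (Bj ν.M₁ Z k) k).symm i).1 (expMulC (X : VecField (F.P Kt) 0 (EuclideanSpace ℂ (Fin 3))) (coeField U₀))
                    ((constrEnum (Bj ν.M₁ Z k) k).symm i).2.1))) 0 ⟨cplxVec p, hp⟩ ⟨cplxVec p, hp⟩)).re ≤ m * ∑ b : PBond (F.P Kt) 0, ‖p b‖ ^ 2) ∧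
      -- DISPLAYED (T1@q₀) over the CLOSURE of NODE 00's class: the tower-central orbit of `U₀` is the unique minimal orbit
      (∀ U ∈ closure (Node00.regMSCoPOfRecord F 2 ν Kt k (maxDomT ν.M₁ Z)),
        AgreeOn (Bj ν.M₁ Z k) (avgFamily (Node00.avOfRecord F 2 Kt) U) (avgFamily (Node00.avOfRecord F 2 Kt) (qsstarGIter0 k (ext Vk))) →
        wilsonAction4 U ≤ wilsonAction4 U₀ →
          ∃ u : GaugeTransf (F.P Kt) 0 SU2, (∀ j, j ≤ k → ∀ b ∈ bondsOf (Bj ν.M₁ Z k j),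
            toMS u j b.src = toMS u j b.tgt ∧ ∀ g : SU2, toMS u j b.src * g = g * toMS u j b.src) ∧ gaugeAct u U = U₀)) :
    ∃ R : ℝ, 0 < R ∧ ∀ Vk ∈ K,
      ∃ Ũ : VecField (F.P Kt) k (EuclideanSpace ℂ (Fin 3)) × VecField (F.P Kt) k (EuclideanSpace ℂ (Fin 3)) → PBond (F.P Kt) 0 → Matrix (Fin 2) (Fin 2) ℂ,
        (∀ b i j, DifferentiableOn ℂ (fun z => Ũ z b i j) (ball 0 R)) ∧
        (∀ z ∈ ball (0 : VecField (F.P Kt) k (EuclideanSpace ℂ (Fin 3)) × VecField (F.P Kt) k (EuclideanSpace ℂ (Fin 3))) R, ∀ b i j, ‖Ũ z b i j‖ ≤ 𝓐₀) ∧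
        ∀ p B' : VecField (F.P Kt) k E3, ‖p‖ < R → ‖B'‖ < R → ∃ U' : GaugeField (F.P Kt) 0 SU2,
          (∀ b, Ũ (cplxVec p, cplxVec B') b = ((U' b : SU2) : Matrix (Fin 2) (Fin 2) ℂ)) ∧
            IsMinimizer (Node00.avOfRecord F 2 Kt) (Node00.regMSCoPOfRecord F 2 ν Kt k (maxDomT ν.M₁ Z)) (Bj ν.M₁ Z k)
              (avgFamily (Node00.avOfRecord F 2 Kt) (qsstarGIter0 k (expMul su2Chart B' (ext (expMul su2Chart p Vk))))) U' := by
  have hk : k ≤ (F.P Kt).m + (F.P Kt).K := Nat.le_of_succ_le hkK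
  have hM4 : 4 * (F.P Kt).L ≤ ν.M₁ := le_trans (Nat.mul_le_mul_right _ (by omega)) hfloor
  have hM : 1 ≤ ν.M₁ := le_trans (Nat.succ_le_of_lt (Nat.mul_pos (Nat.succ_pos _) (F.P Kt).L_pos)) hfloor
  have hd2 : 2 ≤ (F.P Kt).d := le_trans (by norm_num) hd3
  obtain ⟨hreg', hcl, hDreg'⟩ :=
    classLetters_closure_regMSCoPOfRecord_Bj (F := F) (N := 2) (K := Kt) ν hε hk hdiv hfloor Z k (Nat.le_succ k) hα3 hα2
  refine hMin_atRecord_of_node00Letters_thm1AtBase_central_ofClass_nearFlat ν Kt hd2 Z Λ lo hi (Bj ν.M₁ Z k) rfl hkK hM4 hdiv hZblk hε.le hsbU hερ hδ hδρ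
    ext hext hK h𝓐₀ (closure (Node00.regMSCoPOfRecord F 2 ν Kt k (maxDomT ν.M₁ Z))) hreg' hcl hDreg' hk1 hδc0 hnum fun Vk hVk => ?_
  obtain ⟨U₀, hmin, hregZ, hrowNF, hrowP, hrowM, hT1⟩ := hbase Vk hVk
  obtain ⟨path, S, hF1, hF2, -, hF3, -⟩ := exists_forest_slice_Bj (P := F.P Kt) (M₁ := ν.M₁) (Z := Z) hk hk1 hM hdiv
  have hroot : ∀ r ∈ {z : Site (F.P Kt) 0 | ∃ j, j ≤ k ∧ ∃ c ∈ bondsOf ((Bj ν.M₁ Z k : DetSet (F.P Kt)) j), (z = embIter j c.src ∨ z = embIter j c.tgt)},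
      path r = [] := by
    rintro r ⟨j, hj, c, hc, hr | hr⟩
    · rw [hr]; exact (hF2 j hj c hc).1
    · rw [hr]; exact (hF2 j hj c hc).2
  exact ⟨U₀, S, path, _, _, hmin, hregZ, hF1, hF2, hF3, fun _ => rfl, fun _ _ => rfl,
    hH_velocity_Bj_of_isMinimizer_class ν Kt Z hkK hM4 hdiv hε.le hsbU hερ hHB hεH hmin hmin.2.1 S hroot hF1 hF3,
    hrowNF, hrowP S path hF1 hF2 hF3, hrowM S path hF1 hF2 hF3, hT1⟩


/-! ## §2  The same in the `hMinC` shape of the lane's `…Compact` sockets -/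

/-- ★★★ **THE SAME IN THE `hMinC` SHAPE**: §1's per-base-field letters for every base field of the CLOSED small-field guard `{∀ p ∈ G, |V_k(∂p) − 1| ≤ eR}` (any `G`, any `eR`) give the (J0′)
letter on every compact subset of the guard.  One line over §1.
[cite: Balaban1989LargeFieldI, (1.74) p.192, Prop. 1 p.194 (last clause); Balaban1985Variational, Thm 1 p.279, (7) p.278, Prop. 9 (190) p.309; Balaban1988Convergent, (2.12)–(2.13) pp.256–257] -/
theorem hMinC_atRecord_Bj_of_printLetters_ofClassTowerNearFlat (ν : Node00.Stage7Numerics) (Kt : ℕ) (hd3 : 3 ≤ (F.P Kt).d) (Z : Set (Site (F.P Kt) 0))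
    (Λ : Set (Site (F.P Kt) k)) (lo hi : Fin (F.P Kt).d → ℤ) (hkK : k + 1 ≤ (F.P Kt).m + (F.P Kt).K) (hk1 : 1 ≤ k)
    (hdiv : side (F.P Kt).L ν.M₁ k ∣ (F.P Kt).sitesPerDir 0) (hfloor : ((F.P Kt).d + 14) * (F.P Kt).L ≤ ν.M₁) (hZblk : IsBlockUnion k Z) (hε : 0 < ν.εreg)
    (hα3 : (143 * (((((F.P Kt).d + 4 : ℕ) : ℝ)) ^ 2 / 4) ^ 2) * (2 * ((F.P Kt).L : ℝ) ^ 2 * ν.εreg) ≤ 1 / 3)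
    (hα2 : 2 * (2 * ((F.P Kt).L : ℝ) ^ 2 * ν.εreg) ≤ 2 * deltaSU (Fin 2) / ((((F.P Kt).d + 4) * (F.P Kt).L : ℕ) : ℝ) ^ 2)
    -- the per-HEIGHT letters: `ρ″` with its two volume-free floors, dag-n12-w6's (P4)′ proxies letter `hHB` at `(εH, B)` with `εreg ≤ εH`, and the numerics of the (β) split:
    -- the near-flat tolerance `δc`, the flat coercivity constant `cP`, the multiplier constant `m`, with `64(d−1)·δc + m < cP`
    {ρ'' : ℝ} (hsbU : ∀ W : GaugeField (F.P Kt) 0 SU2, ‖coeField W - 1‖ ≤ ρ'' → SmallBelow (Node00.avOfRecord F 2 Kt) k W)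
    (hερ : 6 * ((((F.P Kt).d - 1 : ℕ)) : ℝ) * (F.P Kt).L * ν.εreg ≤ ρ'') {δ : ℝ} (hδ : 0 < δ) (hδρ : 6 * ((((F.P Kt).d - 1 : ℕ)) : ℝ) * (F.P Kt).L ^ k * δ ≤ ρ'')
    {εH B : ℝ}
    (hHB : ∀ (Wd : MSField (F.P Kt) SU2) (U₀ : GaugeField (F.P Kt) 0 SU2),
      AgreeOn (Bj ν.M₁ Z k) (avgFamily (avOfRecord F 2 Kt) U₀) Wd →
      (∀ i' : Fin (constrCard (Bj ν.M₁ Z k) k), ∃ U' : GaugeField (F.P Kt) 0 SU2,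
        (∀ b ∈ feeds (((constrEnum (Bj ν.M₁ Z k) k).symm i').1 : ℕ) ((constrEnum (Bj ν.M₁ Z k) k).symm i').2.1, U' b = U₀ b) ∧
          SmallBelow (avOfRecord F 2 Kt) k U') →
      (∀ (j : ℕ), 1 ≤ j → j ≤ k → ∀ y : Site (F.P Kt) j, embIter j y ∈ maxDomT ν.M₁ Z j → ∃ U' : GaugeField (F.P Kt) 0 SU2,
        (∀ c : PBond (F.P Kt) j, (c.src = y ∨ c.tgt = y) → ∀ b₀ : PBond (F.P Kt) 0,
          (iterBlockOf j b₀.src = c.src ∨ iterBlockOf j b₀.src = c.tgt) → (iterBlockOf j b₀.tgt = c.src ∨ iterBlockOf j b₀.tgt = c.tgt) → U' b₀ = U₀ b₀) ∧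
        SmallBelow (avOfRecord F 2 Kt) k U') →
      (∀ (j : ℕ), 1 ≤ j → j ≤ k → ∀ y : Site (F.P Kt) j, embIter j y ∈ maxDomT ν.M₁ Z j →
        PlaqSmallOn (boxPlaqs (fun κ => lift (F.P Kt) (embIter j y) κ - ((((F.P Kt).L ^ j : ℕ) : ℤ) + ((((F.P Kt).L ^ j - 1) / 2 : ℕ) : ℤ)))
          (fun κ => lift (F.P Kt) (embIter j y) κ + ((((F.P Kt).L ^ j : ℕ) : ℤ) + ((((F.P Kt).L ^ j - 1) / 2 : ℕ) : ℤ))) : Set (Plaq (F.P Kt) 0)) εH U₀) →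
      ∃ H : (Fin (constrCard (Bj ν.M₁ Z k) k) → lieSU (Fin 2)) → PBond (F.P Kt) 0 → lieSU (Fin 2),
        (∀ v, fderiv ℝ (msChart F 2 Kt k (Bj ν.M₁ Z k) Wd U₀) 0 (H v) = v) ∧ ∀ v, Real.sqrt (∑ b, ‖H v b‖ ^ 2) ≤ B * ‖v‖)
    (hεH : ν.εreg ≤ εH)
    {δc cP m : ℝ} (hδc0 : 0 ≤ δc) (hnum : 64 * (((F.P Kt).d : ℝ) - 1) * δc + m < cP)
    (ext : GaugeField (F.P Kt) k SU2 → GaugeField (F.P Kt) k SU2) (hext : ∀ W, ext W = extend Λ (shellGauge W lo hi) W)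
    {𝓐₀ : ℝ} (h𝓐₀ : 1 < 𝓐₀) (G : Set (Plaq (F.P Kt) k)) (eR : ℝ)
    (hletters : ∀ Vk : GaugeField (F.P Kt) k SU2, (∀ p ∈ G, dist1 (GaugeField.plaqHol Vk p) ≤ eR) → ∃ U₀ : GaugeField (F.P Kt) 0 SU2,
      IsMinimizer (Node00.avOfRecord F 2 Kt) (Node00.regMSCoPOfRecord F 2 ν Kt k (maxDomT ν.M₁ Z)) (Bj ν.M₁ Z k)
        (avgFamily (Node00.avOfRecord F 2 Kt) (qsstarGIter0 k (ext Vk))) U₀ ∧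
      -- the DATUM's scale-`k` regularity on `Z` (the p. 193 extension `Ṽ_k = ext V_k`; the road's `B15ShellGauge193Local.dist1_plaqHol_extend_shellGauge_le`)
      PlaqSmallOn (plaqsInside (pts k Z)) δ (ext Vk) ∧
      -- (δ) DISPLAYED (GAUGE letter, the direct road's (N)-package clause): `U₀` bondwise `δc`-flat on the plaquettes meeting a bond sourced in `Ω₁(Z)`
      (∀ q : Plaq (F.P Kt) 0, ((⟨q.src, q.μ⟩ : PBond (F.P Kt) 0) ∈ {b : PBond (F.P Kt) 0 | b.src ∈ maxDomT ν.M₁ Z 1} ∨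
          (⟨q.src.shift q.μ, q.ν⟩ : PBond (F.P Kt) 0) ∈ {b : PBond (F.P Kt) 0 | b.src ∈ maxDomT ν.M₁ Z 1} ∨
          (⟨q.src.shift q.ν, q.μ⟩ : PBond (F.P Kt) 0) ∈ {b : PBond (F.P Kt) 0 | b.src ∈ maxDomT ν.M₁ Z 1} ∨
          (⟨q.src, q.ν⟩ : PBond (F.P Kt) 0) ∈ {b : PBond (F.P Kt) 0 | b.src ∈ maxDomT ν.M₁ Z 1}) →
        ‖((U₀ ⟨q.src, q.μ⟩ : SU2) : Matrix (Fin 2) (Fin 2) ℂ) - 1‖ ≤ δc ∧ ‖((U₀ ⟨q.src.shift q.μ, q.ν⟩ : SU2) : Matrix (Fin 2) (Fin 2) ℂ) - 1‖ ≤ δc ∧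
          ‖((U₀ ⟨q.src.shift q.ν, q.μ⟩ : SU2) : Matrix (Fin 2) (Fin 2) ℂ) - 1‖ ≤ δc ∧ ‖((U₀ ⟨q.src, q.ν⟩ : SU2) : Matrix (Fin 2) (Fin 2) ℂ) - 1‖ ≤ δc) ∧
      -- (P) DISPLAYED ON EVERY FOREST AXIAL SLICE: FLAT COERCIVITY on the real kernel of `DΦ₀(0)` (`Φ₀` inlined) — [LF-II] (1.8) ∕ [10] (1.67) currency
      (∀ (S : Submodule ℂ (VecField (F.P Kt) 0 (EuclideanSpace ℂ (Fin 3)))) (path : Site (F.P Kt) 0 → List (LStep (F.P Kt) 0)),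
        (∀ x, ∀ s ∈ path x, ∃ x' x'' : Site (F.P Kt) 0, path x'' = path x' ++ [s] ∧
          (s.fwd = true → s.bond.src = x' ∧ s.bond.tgt = x'') ∧ (s.fwd = false → s.bond.src = x'' ∧ s.bond.tgt = x')) →
        (∀ j, j ≤ k → ∀ c ∈ bondsOf (Bj ν.M₁ Z k j), path (embIter j c.src) = [] ∧ path (embIter j c.tgt) = []) →
        (∀ X : VecField (F.P Kt) 0 (EuclideanSpace ℂ (Fin 3)), X ∈ S ↔ ∀ x, ∀ s ∈ path x, X s.bond = 0) →
        ∀ (p : VecField (F.P Kt) 0 E3) (hp : cplxVec p ∈ S), fderiv ℂ (fun (X : S) (i : Fin (constrCard (Bj ν.M₁ Z k) k)) =>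
                logCoordC (star ((avgFamily (Node00.avOfRecord F 2 Kt) (qsstarGIter0 k (ext Vk))
                  ((constrEnum (Bj ν.M₁ Z k) k).symm i).1 ((constrEnum (Bj ν.M₁ Z k) k).symm i).2.1 : SU2) : Matrix (Fin 2) (Fin 2) ℂ) *
                  iterMh ((constrEnum (Bj ν.M₁ Z k) k).symm i).1 (expMulC (X : VecField (F.P Kt) 0 (EuclideanSpace ℂ (Fin 3))) (coeField U₀))
                    ((constrEnum (Bj ν.M₁ Z k) k).symm i).2.1)) 0 ⟨cplxVec p, hp⟩ = 0 →
          cP * ∑ b : PBond (F.P Kt) 0, ‖p b‖ ^ 2 ≤ deriv (deriv fun s : ℝ => wilsonAction4 (expMul su2Chart (s • p) (1 : GaugeField (F.P Kt) 0 SU2))) 0) ∧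
      -- (M) DISPLAYED ON EVERY FOREST AXIAL SLICE: the MULTIPLIER letter (`a`, `Φ₀` inlined) — [15] (79) p.290 `Δ₁` currency, dag-n12-w6's (R1) road
      (∀ (S : Submodule ℂ (VecField (F.P Kt) 0 (EuclideanSpace ℂ (Fin 3)))) (path : Site (F.P Kt) 0 → List (LStep (F.P Kt) 0)),
        (∀ x, ∀ s ∈ path x, ∃ x' x'' : Site (F.P Kt) 0, path x'' = path x' ++ [s] ∧
          (s.fwd = true → s.bond.src = x' ∧ s.bond.tgt = x'') ∧ (s.fwd = false → s.bond.src = x'' ∧ s.bond.tgt = x')) →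
        (∀ j, j ≤ k → ∀ c ∈ bondsOf (Bj ν.M₁ Z k j), path (embIter j c.src) = [] ∧ path (embIter j c.tgt) = []) →
        (∀ X : VecField (F.P Kt) 0 (EuclideanSpace ℂ (Fin 3)), X ∈ S ↔ ∀ x, ∀ s ∈ path x, X s.bond = 0) →
        ∀ ℓ₀ : (Fin (constrCard (Bj ν.M₁ Z k) k) → EuclideanSpace ℂ (Fin 3)) →L[ℂ] ℂ, fderiv ℂ (fun X : S => ∑ p : Plaq (F.P Kt) 0, (1 - (expMulC (X : VecField (F.P Kt) 0 (EuclideanSpace ℂ (Fin 3))) (coeField U₀) ⟨p.src, p.μ⟩ *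
              expMulC (X : VecField (F.P Kt) 0 (EuclideanSpace ℂ (Fin 3))) (coeField U₀) ⟨p.src.shift p.μ, p.ν⟩ *
              Matrix.adjugate (expMulC (X : VecField (F.P Kt) 0 (EuclideanSpace ℂ (Fin 3))) (coeField U₀) ⟨p.src.shift p.ν, p.μ⟩) *
              Matrix.adjugate (expMulC (X : VecField (F.P Kt) 0 (EuclideanSpace ℂ (Fin 3))) (coeField U₀) ⟨p.src, p.ν⟩)).trace / 2)) 0 = ℓ₀.comp (fderiv ℂ (fun (X : S) (i : Fin (constrCard (Bj ν.M₁ Z k) k)) =>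
                logCoordC (star ((avgFamily (Node00.avOfRecord F 2 Kt) (qsstarGIter0 k (ext Vk))
                  ((constrEnum (Bj ν.M₁ Z k) k).symm i).1 ((constrEnum (Bj ν.M₁ Z k) k).symm i).2.1 : SU2) : Matrix (Fin 2) (Fin 2) ℂ) *
                  iterMh ((constrEnum (Bj ν.M₁ Z k) k).symm i).1 (expMulC (X : VecField (F.P Kt) 0 (EuclideanSpace ℂ (Fin 3))) (coeField U₀))
                    ((constrEnum (Bj ν.M₁ Z k) k).symm i).2.1)) 0) →
          ∀ (p : VecField (F.P Kt) 0 E3) (hp : cplxVec p ∈ S), fderiv ℂ (fun (X : S) (i : Fin (constrCard (Bj ν.M₁ Z k) k)) =>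
                logCoordC (star ((avgFamily (Node00.avOfRecord F 2 Kt) (qsstarGIter0 k (ext Vk))
                  ((constrEnum (Bj ν.M₁ Z k) k).symm i).1 ((constrEnum (Bj ν.M₁ Z k) k).symm i).2.1 : SU2) : Matrix (Fin 2) (Fin 2) ℂ) *
                  iterMh ((constrEnum (Bj ν.M₁ Z k) k).symm i).1 (expMulC (X : VecField (F.P Kt) 0 (EuclideanSpace ℂ (Fin 3))) (coeField U₀))
                    ((constrEnum (Bj ν.M₁ Z k) k).symm i).2.1)) 0 ⟨cplxVec p, hp⟩ = 0 →
            (ℓ₀ (fderiv ℂ (fderiv ℂ (fun (X : S) (i : Fin (constrCard (Bj ν.M₁ Z k) k)) =>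
                logCoordC (star ((avgFamily (Node00.avOfRecord F 2 Kt) (qsstarGIter0 k (ext Vk))
                  ((constrEnum (Bj ν.M₁ Z k) k).symm i).1 ((constrEnum (Bj ν.M₁ Z k) k).symm i).2.1 : SU2) : Matrix (Fin 2) (Fin 2) ℂ) *
                  iterMh ((constrEnum (Bj ν.M₁ Z k) k).symm i).1 (expMulC (X : VecField (F.P Kt) 0 (EuclideanSpace ℂ (Fin 3))) (coeField U₀))
                    ((constrEnum (Bj ν.M₁ Z k) k).symm i).2.1))) 0 ⟨cplxVec p, hp⟩ ⟨cplxVec p, hp⟩)).re ≤ m * ∑ b : PBond (F.P Kt) 0, ‖p b‖ ^ 2) ∧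
      -- DISPLAYED (T1@q₀) over the CLOSURE of NODE 00's class: the tower-central orbit of `U₀` is the unique minimal orbit
      (∀ U ∈ closure (Node00.regMSCoPOfRecord F 2 ν Kt k (maxDomT ν.M₁ Z)),
        AgreeOn (Bj ν.M₁ Z k) (avgFamily (Node00.avOfRecord F 2 Kt) U) (avgFamily (Node00.avOfRecord F 2 Kt) (qsstarGIter0 k (ext Vk))) →
        wilsonAction4 U ≤ wilsonAction4 U₀ →
          ∃ u : GaugeTransf (F.P Kt) 0 SU2, (∀ j, j ≤ k → ∀ b ∈ bondsOf (Bj ν.M₁ Z k j),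
            toMS u j b.src = toMS u j b.tgt ∧ ∀ g : SU2, toMS u j b.src * g = g * toMS u j b.src) ∧ gaugeAct u U = U₀)) :
    ∀ K : Set (GaugeField (F.P Kt) k SU2), IsCompact K → (∀ Vk ∈ K, ∀ p ∈ G, dist1 (GaugeField.plaqHol Vk p) ≤ eR) →
      ∃ R : ℝ, 0 < R ∧ ∀ Vk ∈ K,
      ∃ Ũ : VecField (F.P Kt) k (EuclideanSpace ℂ (Fin 3)) × VecField (F.P Kt) k (EuclideanSpace ℂ (Fin 3)) → PBond (F.P Kt) 0 → Matrix (Fin 2) (Fin 2) ℂ,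
        (∀ b i j, DifferentiableOn ℂ (fun z => Ũ z b i j) (ball 0 R)) ∧
        (∀ z ∈ ball (0 : VecField (F.P Kt) k (EuclideanSpace ℂ (Fin 3)) × VecField (F.P Kt) k (EuclideanSpace ℂ (Fin 3))) R, ∀ b i j, ‖Ũ z b i j‖ ≤ 𝓐₀) ∧
        ∀ p B' : VecField (F.P Kt) k E3, ‖p‖ < R → ‖B'‖ < R → ∃ U' : GaugeField (F.P Kt) 0 SU2,
          (∀ b, Ũ (cplxVec p, cplxVec B') b = ((U' b : SU2) : Matrix (Fin 2) (Fin 2) ℂ)) ∧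
            IsMinimizer (Node00.avOfRecord F 2 Kt) (Node00.regMSCoPOfRecord F 2 ν Kt k (maxDomT ν.M₁ Z)) (Bj ν.M₁ Z k)
              (avgFamily (Node00.avOfRecord F 2 Kt) (qsstarGIter0 k (expMul su2Chart B' (ext (expMul su2Chart p Vk))))) U' :=
  fun _ hK hG => hMin_atRecord_Bj_of_printLetters_ofClassTowerNearFlat ν Kt hd3 Z Λ lo hi hkK hk1 hdiv hfloor hZblk hε hα3 hα2 hsbU hερ hδ hδρ hHB hεH hδc0 hnum ext hext hK h𝓐₀ fun Vk hVk => hletters Vk (hG Vk hVk)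


/-! ## §3  Read once on the compact closed guard — one radius for all guarded base fields -/

/-- ★★★ **THE SAME, READ ONCE ON THE (COMPACT) CLOSED GUARD — ONE RADIUS FOR ALL GUARDED BASE FIELDS** (`forall_of_forall_isCompact_subset`): `∃ R > 0, ∀ V_k, (∀ p ∈ G, |V_k(∂p) − 1| ≤ eR) →
∃ Ũ, …` from §2 — the shape the knit-row junction consumes at `G := plaqsInside (pts k (Z ∩ Λᶜ))`.
[cite: Balaban1989LargeFieldI, (1.74) p.192, Prop. 1 p.194 (last clause); Balaban1985Variational, Thm 1 p.279, (7) p.278, Prop. 9 (190) p.309; Balaban1988Convergent, (2.12)–(2.13) pp.256–257] -/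
theorem hMin_closedGuard_atRecord_Bj_of_printLetters_ofClassTowerNearFlat (ν : Node00.Stage7Numerics) (Kt : ℕ) (hd3 : 3 ≤ (F.P Kt).d) (Z : Set (Site (F.P Kt) 0))
    (Λ : Set (Site (F.P Kt) k)) (lo hi : Fin (F.P Kt).d → ℤ) (hkK : k + 1 ≤ (F.P Kt).m + (F.P Kt).K) (hk1 : 1 ≤ k)
    (hdiv : side (F.P Kt).L ν.M₁ k ∣ (F.P Kt).sitesPerDir 0) (hfloor : ((F.P Kt).d + 14) * (F.P Kt).L ≤ ν.M₁) (hZblk : IsBlockUnion k Z) (hε : 0 < ν.εreg)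
    (hα3 : (143 * (((((F.P Kt).d + 4 : ℕ) : ℝ)) ^ 2 / 4) ^ 2) * (2 * ((F.P Kt).L : ℝ) ^ 2 * ν.εreg) ≤ 1 / 3)
    (hα2 : 2 * (2 * ((F.P Kt).L : ℝ) ^ 2 * ν.εreg) ≤ 2 * deltaSU (Fin 2) / ((((F.P Kt).d + 4) * (F.P Kt).L : ℕ) : ℝ) ^ 2)
    -- the per-HEIGHT letters: `ρ″` with its two volume-free floors, dag-n12-w6's (P4)′ proxies letter `hHB` at `(εH, B)` with `εreg ≤ εH`, and the numerics of the (β) split: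
    -- the near-flat tolerance `δc`, the flat coercivity constant `cP`, the multiplier constant `m`, with `64(d−1)·δc + m < cP`
    {ρ'' : ℝ} (hsbU : ∀ W : GaugeField (F.P Kt) 0 SU2, ‖coeField W - 1‖ ≤ ρ'' → SmallBelow (Node00.avOfRecord F 2 Kt) k W)
    (hερ : 6 * ((((F.P Kt).d - 1 : ℕ)) : ℝ) * (F.P Kt).L * ν.εreg ≤ ρ'') {δ : ℝ} (hδ : 0 < δ) (hδρ : 6 * ((((F.P Kt).d - 1 : ℕ)) : ℝ) * (F.P Kt).L ^ k * δ ≤ ρ'')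
    {εH B : ℝ}
    (hHB : ∀ (Wd : MSField (F.P Kt) SU2) (U₀ : GaugeField (F.P Kt) 0 SU2),
      AgreeOn (Bj ν.M₁ Z k) (avgFamily (avOfRecord F 2 Kt) U₀) Wd →
      (∀ i' : Fin (constrCard (Bj ν.M₁ Z k) k), ∃ U' : GaugeField (F.P Kt) 0 SU2,
        (∀ b ∈ feeds (((constrEnum (Bj ν.M₁ Z k) k).symm i').1 : ℕ) ((constrEnum (Bj ν.M₁ Z k) k).symm i').2.1, U' b = U₀ b) ∧
          SmallBelow (avOfRecord F 2 Kt) k U') →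
      (∀ (j : ℕ), 1 ≤ j → j ≤ k → ∀ y : Site (F.P Kt) j, embIter j y ∈ maxDomT ν.M₁ Z j → ∃ U' : GaugeField (F.P Kt) 0 SU2,
        (∀ c : PBond (F.P Kt) j, (c.src = y ∨ c.tgt = y) → ∀ b₀ : PBond (F.P Kt) 0,
          (iterBlockOf j b₀.src = c.src ∨ iterBlockOf j b₀.src = c.tgt) → (iterBlockOf j b₀.tgt = c.src ∨ iterBlockOf j b₀.tgt = c.tgt) → U' b₀ = U₀ b₀) ∧
        SmallBelow (avOfRecord F 2 Kt) k U') →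
      (∀ (j : ℕ), 1 ≤ j → j ≤ k → ∀ y : Site (F.P Kt) j, embIter j y ∈ maxDomT ν.M₁ Z j →
        PlaqSmallOn (boxPlaqs (fun κ => lift (F.P Kt) (embIter j y) κ - ((((F.P Kt).L ^ j : ℕ) : ℤ) + ((((F.P Kt).L ^ j - 1) / 2 : ℕ) : ℤ)))
          (fun κ => lift (F.P Kt) (embIter j y) κ + ((((F.P Kt).L ^ j : ℕ) : ℤ) + ((((F.P Kt).L ^ j - 1) / 2 : ℕ) : ℤ))) : Set (Plaq (F.P Kt) 0)) εH U₀) →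
      ∃ H : (Fin (constrCard (Bj ν.M₁ Z k) k) → lieSU (Fin 2)) → PBond (F.P Kt) 0 → lieSU (Fin 2),
        (∀ v, fderiv ℝ (msChart F 2 Kt k (Bj ν.M₁ Z k) Wd U₀) 0 (H v) = v) ∧ ∀ v, Real.sqrt (∑ b, ‖H v b‖ ^ 2) ≤ B * ‖v‖)
    (hεH : ν.εreg ≤ εH)
    {δc cP m : ℝ} (hδc0 : 0 ≤ δc) (hnum : 64 * (((F.P Kt).d : ℝ) - 1) * δc + m < cP)
    (ext : GaugeField (F.P Kt) k SU2 → GaugeField (F.P Kt) k SU2) (hext : ∀ W, ext W = extend Λ (shellGauge W lo hi) W)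
    {𝓐₀ : ℝ} (h𝓐₀ : 1 < 𝓐₀) (G : Set (Plaq (F.P Kt) k)) (eR : ℝ)
    (hletters : ∀ Vk : GaugeField (F.P Kt) k SU2, (∀ p ∈ G, dist1 (GaugeField.plaqHol Vk p) ≤ eR) → ∃ U₀ : GaugeField (F.P Kt) 0 SU2,
      IsMinimizer (Node00.avOfRecord F 2 Kt) (Node00.regMSCoPOfRecord F 2 ν Kt k (maxDomT ν.M₁ Z)) (Bj ν.M₁ Z k)
        (avgFamily (Node00.avOfRecord F 2 Kt) (qsstarGIter0 k (ext Vk))) U₀ ∧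
      -- the DATUM's scale-`k` regularity on `Z` (the p. 193 extension `Ṽ_k = ext V_k`; the road's `B15ShellGauge193Local.dist1_plaqHol_extend_shellGauge_le`)
      PlaqSmallOn (plaqsInside (pts k Z)) δ (ext Vk) ∧
      -- (δ) DISPLAYED (GAUGE letter, the direct road's (N)-package clause): `U₀` bondwise `δc`-flat on the plaquettes meeting a bond sourced in `Ω₁(Z)`
      (∀ q : Plaq (F.P Kt) 0, ((⟨q.src, q.μ⟩ : PBond (F.P Kt) 0) ∈ {b : PBond (F.P Kt) 0 | b.src ∈ maxDomT ν.M₁ Z 1} ∨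
          (⟨q.src.shift q.μ, q.ν⟩ : PBond (F.P Kt) 0) ∈ {b : PBond (F.P Kt) 0 | b.src ∈ maxDomT ν.M₁ Z 1} ∨
          (⟨q.src.shift q.ν, q.μ⟩ : PBond (F.P Kt) 0) ∈ {b : PBond (F.P Kt) 0 | b.src ∈ maxDomT ν.M₁ Z 1} ∨
          (⟨q.src, q.ν⟩ : PBond (F.P Kt) 0) ∈ {b : PBond (F.P Kt) 0 | b.src ∈ maxDomT ν.M₁ Z 1}) →
        ‖((U₀ ⟨q.src, q.μ⟩ : SU2) : Matrix (Fin 2) (Fin 2) ℂ) - 1‖ ≤ δc ∧ ‖((U₀ ⟨q.src.shift q.μ, q.ν⟩ : SU2) : Matrix (Fin 2) (Fin 2) ℂ) - 1‖ ≤ δc ∧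
          ‖((U₀ ⟨q.src.shift q.ν, q.μ⟩ : SU2) : Matrix (Fin 2) (Fin 2) ℂ) - 1‖ ≤ δc ∧ ‖((U₀ ⟨q.src, q.ν⟩ : SU2) : Matrix (Fin 2) (Fin 2) ℂ) - 1‖ ≤ δc) ∧
      -- (P) DISPLAYED ON EVERY FOREST AXIAL SLICE: FLAT COERCIVITY on the real kernel of `DΦ₀(0)` (`Φ₀` inlined) — [LF-II] (1.8) ∕ [10] (1.67) currency
      (∀ (S : Submodule ℂ (VecField (F.P Kt) 0 (EuclideanSpace ℂ (Fin 3)))) (path : Site (F.P Kt) 0 → List (LStep (F.P Kt) 0)),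
        (∀ x, ∀ s ∈ path x, ∃ x' x'' : Site (F.P Kt) 0, path x'' = path x' ++ [s] ∧
          (s.fwd = true → s.bond.src = x' ∧ s.bond.tgt = x'') ∧ (s.fwd = false → s.bond.src = x'' ∧ s.bond.tgt = x')) →
        (∀ j, j ≤ k → ∀ c ∈ bondsOf (Bj ν.M₁ Z k j), path (embIter j c.src) = [] ∧ path (embIter j c.tgt) = []) →
        (∀ X : VecField (F.P Kt) 0 (EuclideanSpace ℂ (Fin 3)), X ∈ S ↔ ∀ x, ∀ s ∈ path x, X s.bond = 0) →
        ∀ (p : VecField (F.P Kt) 0 E3) (hp : cplxVec p ∈ S), fderiv ℂ (fun (X : S) (i : Fin (constrCard (Bj ν.M₁ Z k) k)) =>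
                logCoordC (star ((avgFamily (Node00.avOfRecord F 2 Kt) (qsstarGIter0 k (ext Vk))
                  ((constrEnum (Bj ν.M₁ Z k) k).symm i).1 ((constrEnum (Bj ν.M₁ Z k) k).symm i).2.1 : SU2) : Matrix (Fin 2) (Fin 2) ℂ) *
                  iterMh ((constrEnum (Bj ν.M₁ Z k) k).symm i).1 (expMulC (X : VecField (F.P Kt) 0 (EuclideanSpace ℂ (Fin 3))) (coeField U₀))
                    ((constrEnum (Bj ν.M₁ Z k) k).symm i).2.1)) 0 ⟨cplxVec p, hp⟩ = 0 →
          cP * ∑ b : PBond (F.P Kt) 0, ‖p b‖ ^ 2 ≤ deriv (deriv fun s : ℝ => wilsonAction4 (expMul su2Chart (s • p) (1 : GaugeField (F.P Kt) 0 SU2))) 0) ∧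
      -- (M) DISPLAYED ON EVERY FOREST AXIAL SLICE: the MULTIPLIER letter (`a`, `Φ₀` inlined) — [15] (79) p.290 `Δ₁` currency, dag-n12-w6's (R1) road
      (∀ (S : Submodule ℂ (VecField (F.P Kt) 0 (EuclideanSpace ℂ (Fin 3)))) (path : Site (F.P Kt) 0 → List (LStep (F.P Kt) 0)),
        (∀ x, ∀ s ∈ path x, ∃ x' x'' : Site (F.P Kt) 0, path x'' = path x' ++ [s] ∧
          (s.fwd = true → s.bond.src = x' ∧ s.bond.tgt = x'') ∧ (s.fwd = false → s.bond.src = x'' ∧ s.bond.tgt = x')) →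
        (∀ j, j ≤ k → ∀ c ∈ bondsOf (Bj ν.M₁ Z k j), path (embIter j c.src) = [] ∧ path (embIter j c.tgt) = []) →
        (∀ X : VecField (F.P Kt) 0 (EuclideanSpace ℂ (Fin 3)), X ∈ S ↔ ∀ x, ∀ s ∈ path x, X s.bond = 0) →
        ∀ ℓ₀ : (Fin (constrCard (Bj ν.M₁ Z k) k) → EuclideanSpace ℂ (Fin 3)) →L[ℂ] ℂ, fderiv ℂ (fun X : S => ∑ p : Plaq (F.P Kt) 0, (1 - (expMulC (X : VecField (F.P Kt) 0 (EuclideanSpace ℂ (Fin 3))) (coeField U₀) ⟨p.src, p.μ⟩ *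
              expMulC (X : VecField (F.P Kt) 0 (EuclideanSpace ℂ (Fin 3))) (coeField U₀) ⟨p.src.shift p.μ, p.ν⟩ *
              Matrix.adjugate (expMulC (X : VecField (F.P Kt) 0 (EuclideanSpace ℂ (Fin 3))) (coeField U₀) ⟨p.src.shift p.ν, p.μ⟩) *
              Matrix.adjugate (expMulC (X : VecField (F.P Kt) 0 (EuclideanSpace ℂ (Fin 3))) (coeField U₀) ⟨p.src, p.ν⟩)).trace / 2)) 0 = ℓ₀.comp (fderiv ℂ (fun (X : S) (i : Fin (constrCard (Bj ν.M₁ Z k) k)) =>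
                logCoordC (star ((avgFamily (Node00.avOfRecord F 2 Kt) (qsstarGIter0 k (ext Vk))
                  ((constrEnum (Bj ν.M₁ Z k) k).symm i).1 ((constrEnum (Bj ν.M₁ Z k) k).symm i).2.1 : SU2) : Matrix (Fin 2) (Fin 2) ℂ) *
                  iterMh ((constrEnum (Bj ν.M₁ Z k) k).symm i).1 (expMulC (X : VecField (F.P Kt) 0 (EuclideanSpace ℂ (Fin 3))) (coeField U₀))
                    ((constrEnum (Bj ν.M₁ Z k) k).symm i).2.1)) 0) →
          ∀ (p : VecField (F.P Kt) 0 E3) (hp : cplxVec p ∈ S), fderiv ℂ (fun (X : S) (i : Fin (constrCard (Bj ν.M₁ Z k) k)) =>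
                logCoordC (star ((avgFamily (Node00.avOfRecord F 2 Kt) (qsstarGIter0 k (ext Vk))
                  ((constrEnum (Bj ν.M₁ Z k) k).symm i).1 ((constrEnum (Bj ν.M₁ Z k) k).symm i).2.1 : SU2) : Matrix (Fin 2) (Fin 2) ℂ) *
                  iterMh ((constrEnum (Bj ν.M₁ Z k) k).symm i).1 (expMulC (X : VecField (F.P Kt) 0 (EuclideanSpace ℂ (Fin 3))) (coeField U₀))
                    ((constrEnum (Bj ν.M₁ Z k) k).symm i).2.1)) 0 ⟨cplxVec p, hp⟩ = 0 →
            (ℓ₀ (fderiv ℂ (fderiv ℂ (fun (X : S) (i : Fin (constrCard (Bj ν.M₁ Z k) k)) =>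
                logCoordC (star ((avgFamily (Node00.avOfRecord F 2 Kt) (qsstarGIter0 k (ext Vk))
                  ((constrEnum (Bj ν.M₁ Z k) k).symm i).1 ((constrEnum (Bj ν.M₁ Z k) k).symm i).2.1 : SU2) : Matrix (Fin 2) (Fin 2) ℂ) *
                  iterMh ((constrEnum (Bj ν.M₁ Z k) k).symm i).1 (expMulC (X : VecField (F.P Kt) 0 (EuclideanSpace ℂ (Fin 3))) (coeField U₀))
                    ((constrEnum (Bj ν.M₁ Z k) k).symm i).2.1))) 0 ⟨cplxVec p, hp⟩ ⟨cplxVec p, hp⟩)).re ≤ m * ∑ b : PBond (F.P Kt) 0, ‖p b‖ ^ 2) ∧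
      -- DISPLAYED (T1@q₀) over the CLOSURE of NODE 00's class: the tower-central orbit of `U₀` is the unique minimal orbit
      (∀ U ∈ closure (Node00.regMSCoPOfRecord F 2 ν Kt k (maxDomT ν.M₁ Z)),
        AgreeOn (Bj ν.M₁ Z k) (avgFamily (Node00.avOfRecord F 2 Kt) U) (avgFamily (Node00.avOfRecord F 2 Kt) (qsstarGIter0 k (ext Vk))) →
        wilsonAction4 U ≤ wilsonAction4 U₀ →
          ∃ u : GaugeTransf (F.P Kt) 0 SU2, (∀ j, j ≤ k → ∀ b ∈ bondsOf (Bj ν.M₁ Z k j),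
            toMS u j b.src = toMS u j b.tgt ∧ ∀ g : SU2, toMS u j b.src * g = g * toMS u j b.src) ∧ gaugeAct u U = U₀)) :
    ∃ R : ℝ, 0 < R ∧ ∀ Vk : GaugeField (F.P Kt) k SU2, (∀ p ∈ G, dist1 (GaugeField.plaqHol Vk p) ≤ eR) →
      ∃ Ũ : VecField (F.P Kt) k (EuclideanSpace ℂ (Fin 3)) × VecField (F.P Kt) k (EuclideanSpace ℂ (Fin 3)) → PBond (F.P Kt) 0 → Matrix (Fin 2) (Fin 2) ℂ,
        (∀ b i j, DifferentiableOn ℂ (fun z => Ũ z b i j) (ball 0 R)) ∧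
        (∀ z ∈ ball (0 : VecField (F.P Kt) k (EuclideanSpace ℂ (Fin 3)) × VecField (F.P Kt) k (EuclideanSpace ℂ (Fin 3))) R, ∀ b i j, ‖Ũ z b i j‖ ≤ 𝓐₀) ∧
        ∀ p B' : VecField (F.P Kt) k E3, ‖p‖ < R → ‖B'‖ < R → ∃ U' : GaugeField (F.P Kt) 0 SU2,
          (∀ b, Ũ (cplxVec p, cplxVec B') b = ((U' b : SU2) : Matrix (Fin 2) (Fin 2) ℂ)) ∧
            IsMinimizer (Node00.avOfRecord F 2 Kt) (Node00.regMSCoPOfRecord F 2 ν Kt k (maxDomT ν.M₁ Z)) (Bj ν.M₁ Z k)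
              (avgFamily (Node00.avOfRecord F 2 Kt) (qsstarGIter0 k (expMul su2Chart B' (ext (expMul su2Chart p Vk))))) U' :=
  forall_of_forall_isCompact_subset G eR (fun R Vk =>
      ∃ Ũ : VecField (F.P Kt) k (EuclideanSpace ℂ (Fin 3)) × VecField (F.P Kt) k (EuclideanSpace ℂ (Fin 3)) → PBond (F.P Kt) 0 → Matrix (Fin 2) (Fin 2) ℂ,
      (∀ b i j, DifferentiableOn ℂ (fun z => Ũ z b i j) (ball 0 R)) ∧
      (∀ z ∈ ball (0 : VecField (F.P Kt) k (EuclideanSpace ℂ (Fin 3)) × VecField (F.P Kt) k (EuclideanSpace ℂ (Fin 3))) R, ∀ b i j, ‖Ũ z b i j‖ ≤ 𝓐₀) ∧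
      ∀ p B' : VecField (F.P Kt) k E3, ‖p‖ < R → ‖B'‖ < R → ∃ U' : GaugeField (F.P Kt) 0 SU2,
      (∀ b, Ũ (cplxVec p, cplxVec B') b = ((U' b : SU2) : Matrix (Fin 2) (Fin 2) ℂ)) ∧
      IsMinimizer (Node00.avOfRecord F 2 Kt) (Node00.regMSCoPOfRecord F 2 ν Kt k (maxDomT ν.M₁ Z)) (Bj ν.M₁ Z k)
      (avgFamily (Node00.avOfRecord F 2 Kt) (qsstarGIter0 k (expMul su2Chart B' (ext (expMul su2Chart p Vk))))) U')
    (hMinC_atRecord_Bj_of_printLetters_ofClassTowerNearFlat ν Kt hd3 Z Λ lo hi hkK hk1 hdiv hfloor hZblk hε hα3 hα2 hsbU hερ hδ hδρ hHB hεH hδc0 hnum ext hext h𝓐₀ G eR hletters)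

end Summit.QuantumFields.YangMills.BalabanUVNodes.N12MinimiserFamilyAtRecordBjTowerNearFlat

end
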